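import Literature.Geometry.Kaehler.ComplexTorusIntegralHardLefschetzDegreeTwo
import HarnessLib

/-!
# The cokernel of the divided power `θ^{[g−2]} : H²(X, ℤ) → H^{2g−2}(X, ℤ)` on a principally polarised
# abelian variety is cyclic of order `g − 1`, generated by the minimal class `θ^{[g−1]} = θ^{∧(g−1)}/(g−1)!`

Layer `Literature/Geometry/Kaehler`, namespace `Literature.Geometry.Kaehler.ComplexTorus`; lane `lit-hodgefound` (Track 2
foundations library), seat p09, generation 35, row g35-#4. THEOREMS ONLY (0 definitions); no named fact, net debt 0. Sequel of
g35-#3 `ComplexTorusIntegralHardLefschetzDegreeTwo` (`[(g−2)!·H^{2g−2}(X, ℤ) : θ^{∧(g−2)} ∧ H²(X, ℤ)] = g − 1` for a principal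
polarisation) and g35-#1 §6 (`θ^{∧q} = q! · γ`, `γ ∈ H^{2q}(X, ℤ)`: the divided powers are integral).

Sources (the statements being combined):

* Lange 2023 §4.2 **Poincaré's formula** (PDF p. 204) "`[W_{g−d}] = (1/d!) ∧^d [Θ]`", in particular the minimal class
  `[C] = θ^{g−1}/(g−1)!` of a curve in its Jacobian, and §4.7.1 Cor. 4.7.2 (PDF p. 229); §2.5.3 Thm. 2.5.16 / Cor. 2.5.17 (PDF p. 135:
  `∧^q θ = q! Σ_T (∏_{ν∈T} d_ν) ω_T` on a symplectic basis — so `θ^{[q]} := θ^{∧q}/q!` is an INTEGRAL class);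
* Lange 2023 §5.4.1 Thm. 5.4.1 (hard Lefschetz) and (5.22) (PDF p. 275; the Lefschetz operator on the torsion-free integral cohomology),
  Voisin 2002 §7.1.2 (PDF p. 134 L31); Lange 2023 §1.1.3 Lemma 1.1.17 (integral classes take integral values on the lattice).

With `S := θ^{∧(g−2)} ∧ H²(X, ℤ) ⊆ N := (g−2)! · H^{2g−2}(X, ℤ)` (`g = j + 2`, `θ = ofRealForm η`), the quotient `N/S` is the cokernel
of the divided power `θ^{[g−2]} = θ^{∧(g−2)}/(g−2)!` on the lattices, of order `g − 1` for a principal polarisation (g35-#3). This file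
identifies a generator: the class of `m := (g−2)! · θ^{[g−1]} = θ^{∧(g−1)}/(g−1) ∈ N`. For a symplectic enumeration with `d₁ = 1`
(`θ` primitive in `H²(X, ℤ)`) one has `k · m ∈ S ⟺ (g−1) ∣ k` — hard Lefschetz injectivity of `L^{g−2}` on `H²(X, ℂ)` turns
`k · m = θ^{∧(g−2)} ∧ x` into `(g−1) x = k θ` in `H²(X, ℤ)`, and evaluating on `(λ₁, μ₁)` (`θ(λ₁, μ₁) = d₁ = 1`, `x(λ₁, μ₁) ∈ ℤ`)
gives `(g−1) ∣ k`. For the principal type `(1, …, 1)`, comparing `[S ⊔ ℤm : S] = [ℤ : (g−1)ℤ] = g − 1` with `[N : S] = g − 1`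
gives `N = S ⊔ ℤ·m`: **the cokernel of `θ^{[g−2]}` is cyclic of order `g − 1`, generated by the minimal class** — e.g.
`H⁴(X, ℤ)/θ ∧ H²(X, ℤ) = ℤ/2 · [θ²/2]` on a p.p. threefold and `coker θ^{[2]} = ℤ/3 · [θ³/3!]` on a p.p. fourfold.

## Contents (theorems only; `g = j + 2`, symplectic enumeration `e₀` of type `d` for `η`)

* §1 `exists_int_apply_pair_of_mem_integralForms_two` (integral classes have integral periods on basis pairs),
  `IsSymplecticEnum.ofRealForm_apply_pair` (`θ(λ_a, μ_a) = d_a`), `eq_of_wedgePow_wedge_eq_of_orientation` (hard Lefschetz: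
  `θ^{∧j} ∧ x = θ^{∧j} ∧ y ⟹ x = y` on `H²(X, ℂ)`), **`IsSymplecticEnum.intCast_smul_mem_map_wedgePow_wedge_iff`** (the order of the
  minimal-class generator: `k · m ∈ S ⟺ (g−1) ∣ k` when `d₁ = 1`).
* §2 **`IsSymplecticEnum.map_nsmul_eq_map_wedgePow_wedge_sup_zmultiples`** (type `(1, …, 1)`: `N = S ⊔ ℤ·m`),
  `IsSymplecticEnum.relIndex_map_wedgePow_wedge_sup_zmultiples` (`[S ⊔ ℤm : S] = g − 1`).
* §3 basis-free: **`IsPrincipalPolarization.exists_minimalClass_generates_cokernel`** (`∃ γ ∈ H^{2g−2}(X, ℤ)`,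
  `θ^{∧(g−1)} = (g−1)!·γ`, `N = S ⊔ ℤ·(g−2)!γ`, and `k·(g−2)!γ ∈ S ⟺ (g−1) ∣ k`).

## References

* [cite: Lange2023AbelianVarietiesComplex, §4.2 Poincaré's formula (PDF p. 204); §4.7.1 Cor. 4.7.2 (PDF p. 229); §2.5.3 Thm. 2.5.16 and
  Cor. 2.5.17 (PDF p. 135); §5.4.1 Thm. 5.4.1 and (5.22) (PDF p. 275); §1.1.3 Lemma 1.1.17; §2.1.1 (principal)]
* [cite: VoisinHodgeI2002, §7.1.2 (PDF p. 134 L31)]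
-/

noncomputable section

open Module Function
open Literature.LinearAlgebra.Alternating

namespace Literature.Geometry.Kaehler.ComplexTorus

section DegreeTwoCokernel

variable {ι : Type*} [Fintype ι] [DecidableEq ι] {E : Type*} [NormedAddCommGroup E] [NormedSpace ℂ E]
  (Φ : (ι → ℝ) ≃L[ℝ] E) {j : ℕ} {e₀ : Fin (j + 2) ⊕ Fin (j + 2) ≃ ι} {η : E [⋀^Fin 2]→L[ℝ] ℝ} {d : Fin (j + 2) → ℕ}

/-! ## §1 The order of the minimal-class generator `m = θ^{∧(g−1)}/(g−1)` modulo `θ^{∧(g−2)} ∧ H²(X, ℤ)` -/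

omit [Fintype ι] in
/-- An integral class of degree two has integral periods on the pairs of basis vectors `(e_a, e_b)` of the lattice.
[cite: Lange2023AbelianVarietiesComplex, §1.1.3 Lemma 1.1.17] -/
theorem exists_int_apply_pair_of_mem_integralForms_two {x : E [⋀^Fin 2]→L[ℝ] ℂ} (hx : x ∈ integralForms Φ 2) (a b : ι) :
    ∃ z : ℤ, x ![Φ (Pi.single a 1), Φ (Pi.single b 1)] = z := by
  obtain ⟨z, hz⟩ := hx ![Pi.single a 1, Pi.single b 1]
  refine ⟨z, ?_⟩
  rw [← hz]
  congr 1
  funext i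
  fin_cases i <;> simp [latticeVec_single]

omit [Fintype ι] in
/-- **`θ(λ_a, μ_a) = d_a`** for a symplectic enumeration of type `d` (`θ = ofRealForm η`).
[cite: Lange2023AbelianVarietiesComplex, §2.5.3 (p. 133), §1.5.1] -/
theorem IsSymplecticEnum.ofRealForm_apply_pair (h : IsSymplecticEnum Φ e₀ η d) (a : Fin (j + 2)) :
    ofRealForm η ![Φ (Pi.single (e₀ (Sum.inl a)) 1), Φ (Pi.single (e₀ (Sum.inr a)) 1)] = (d a : ℂ) := by
  rw [ofRealForm_apply, h.left_right, if_pos rfl, Complex.ofReal_natCast]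

omit [DecidableEq ι] in
/-- **Hard Lefschetz injectivity of `L^{g−2}` on `H²(X, ℂ)`**: `θ^{∧j} ∧ x = θ^{∧j} ∧ y ⟹ x = y` (`g = j + 2`, `η` a Riemann form).
[cite: Lange2023AbelianVarietiesComplex, §5.4.1 Thm. 5.4.1 (PDF p. 275)] [cite: VoisinHodgeI2002, §6.2.3 Thm. 6.25 (PDF p. 125)] -/
theorem eq_of_wedgePow_wedge_eq_of_orientation (e : Fin (2 * (j + 2)) ≃ ι) (hη : IsRiemannForm Φ η)
    {x y : E [⋀^Fin 2]→L[ℝ] ℂ} (hxy : (wedgePow (ofRealForm η) j).wedge x = (wedgePow (ofRealForm η) j).wedge y) :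
    x = y := by
  haveI := finiteDimensional_real Φ e
  haveI : FiniteDimensional ℂ E := Module.Finite.of_restrictScalars_finite ℝ ℂ E
  have hg : finrank ℂ E = j + 2 := finrank_eq_of_finTwoMulEquiv Φ e
  exact wedgePow_wedge_injective (IsRiemannForm.exists_apply_ne_zero Φ hη) (k := 2) (j := j) (by rw [hg, add_comm]) hxy

/-- **The order of the minimal-class generator.** Let `θ^{∧(j+1)} = (j+1)! · γ` with `γ ∈ H^{2j+2}(X, ℤ)` (the integral class
`θ^{[g−1]}`, `g = j + 2`; g35-#1 `exists_mem_integralForms_wedgePow_eq_factorial_smul`) and `m := j! · γ = θ^{∧(j+1)}/(j+1)`. For a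
symplectic enumeration with `d₁ = 1` (`θ` primitive): **`k · m ∈ θ^{∧j} ∧ H²(X, ℤ) ⟺ (j+1) ∣ k`**. (`⟸`: `(j+1)l · m = l θ^{∧(j+1)} =
θ^{∧j} ∧ (lθ)`. `⟹`: `k·m = θ^{∧j} ∧ x` gives `θ^{∧j} ∧ ((j+1)x) = θ^{∧j} ∧ (kθ)`, so `(j+1) x = k θ` by hard Lefschetz, and on
`(λ₁, μ₁)`: `(j+1) · x(λ₁, μ₁) = k · d₁ = k` with `x(λ₁, μ₁) ∈ ℤ`.)
[cite: Lange2023AbelianVarietiesComplex, §4.2 Poincaré's formula (PDF p. 204), §2.5.3 Thm. 2.5.16 (PDF p. 135), §5.4.1 Thm. 5.4.1 (PDF p. 275), §1.1.3 Lemma 1.1.17] [cite: VoisinHodgeI2002, §7.1.2 (PDF p. 134 L31)] -/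
theorem IsSymplecticEnum.intCast_smul_mem_map_wedgePow_wedge_iff (h : IsSymplecticEnum Φ e₀ η d) (hη : IsRiemannForm Φ η)
    (h0 : d 0 = 1) {γ : E [⋀^Fin (2 * j + 2)]→L[ℝ] ℂ}
    (hγ : wedgePow (ofRealForm η) (j + 1) = ((j + 1).factorial : ℂ) • γ) (k : ℤ) :
    (k : ℂ) • ((j.factorial : ℂ) • γ) ∈ (integralForms Φ 2).map (AddMonoidHom.mk'
        (fun x : E [⋀^Fin 2]→L[ℝ] ℂ ↦ (wedgePow (ofRealForm η) j).wedge x)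
        (ContinuousAlternatingMap.wedge_add_right _)) ↔ ((j + 1 : ℕ) : ℤ) ∣ k := by
  have hθ2 : ofRealForm η ∈ integralForms Φ 2 := ofRealForm_mem_integralForms_two Φ hη.isNSForm
  -- `θ^{∧(j+1)} = θ^{∧j} ∧ θ = (j+1) · m`
  have hsucc : (wedgePow (ofRealForm η) j).wedge (ofRealForm η) = ((j + 1 : ℕ) : ℂ) • ((j.factorial : ℂ) • γ) := by
    rw [← wedgePow_succ, hγ, smul_smul, ← Nat.cast_mul, Nat.factorial_succ]
  constructor
  · rintro ⟨x, hx, hkx⟩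
    change (wedgePow (ofRealForm η) j).wedge x = (k : ℂ) • ((j.factorial : ℂ) • γ) at hkx
    -- `θ^{∧j} ∧ ((j+1) x) = θ^{∧j} ∧ (k θ)`
    have heq : (wedgePow (ofRealForm η) j).wedge (((j + 1 : ℕ) : ℂ) • x) =
        (wedgePow (ofRealForm η) j).wedge ((k : ℂ) • ofRealForm η) := by
      rw [wedge_smul_right_complex, wedge_smul_right_complex, hkx, hsucc]
      simp only [smul_smul]
      congr 1
      ring
    have hx' := eq_of_wedgePow_wedge_eq_of_orientation Φ (ilvEnum e₀) hη heq
    -- evaluate on `(λ₁, μ₁)`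
    obtain ⟨z, hz⟩ := exists_int_apply_pair_of_mem_integralForms_two Φ hx (e₀ (Sum.inl 0)) (e₀ (Sum.inr 0))
    have hev := congrArg (fun f : E [⋀^Fin 2]→L[ℝ] ℂ ↦ f ![Φ (Pi.single (e₀ (Sum.inl 0)) 1), Φ (Pi.single (e₀ (Sum.inr 0)) 1)])
      hx'
    simp only [ContinuousAlternatingMap.smul_apply, hz, h.ofRealForm_apply_pair Φ, h0, Nat.cast_one, smul_eq_mul,
      mul_one] at hev
    refine ⟨z, ?_⟩
    exact_mod_cast hev.symm
  · rintro ⟨l, rfl⟩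
    refine ⟨(l : ℂ) • ofRealForm η, intCast_smul_mem_integralForms Φ hθ2 l, ?_⟩
    change (wedgePow (ofRealForm η) j).wedge ((l : ℂ) • ofRealForm η) = _
    rw [wedge_smul_right_complex, hsucc, smul_smul, Int.cast_mul, Int.cast_natCast]
    congr 1
    ring

/-! ## §2 Principal type: `(g−2)! · H^{2g−2}(X, ℤ) = θ^{∧(g−2)} ∧ H²(X, ℤ) + ℤ · m` -/

/-- **`[θ^{∧j} ∧ H²(X, ℤ) ⊔ ℤ·m : θ^{∧j} ∧ H²(X, ℤ)] = j + 1`** for `m = θ^{∧(j+1)}/(j+1)` and a symplectic enumeration with `d₁ = 1`: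
the index equals `[ℤ : (j+1)ℤ]` through `k ↦ k · m` (§1). [cite: Lange2023AbelianVarietiesComplex, §4.2 (PDF p. 204), §5.4.1 (5.22) (PDF p. 275)] -/
theorem IsSymplecticEnum.relIndex_map_wedgePow_wedge_sup_zmultiples (h : IsSymplecticEnum Φ e₀ η d) (hη : IsRiemannForm Φ η)
    (h0 : d 0 = 1) {γ : E [⋀^Fin (2 * j + 2)]→L[ℝ] ℂ}
    (hγ : wedgePow (ofRealForm η) (j + 1) = ((j + 1).factorial : ℂ) • γ) :
    ((integralForms Φ 2).map (AddMonoidHom.mk'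
        (fun x : E [⋀^Fin 2]→L[ℝ] ℂ ↦ (wedgePow (ofRealForm η) j).wedge x)
        (ContinuousAlternatingMap.wedge_add_right _))).relIndex
      ((integralForms Φ 2).map (AddMonoidHom.mk'
        (fun x : E [⋀^Fin 2]→L[ℝ] ℂ ↦ (wedgePow (ofRealForm η) j).wedge x)
        (ContinuousAlternatingMap.wedge_add_right _)) ⊔ AddSubgroup.zmultiples ((j.factorial : ℂ) • γ)) = j + 1 := by
  set S := (integralForms Φ 2).map (AddMonoidHom.mk'
        (fun x : E [⋀^Fin 2]→L[ℝ] ℂ ↦ (wedgePow (ofRealForm η) j).wedge x)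
        (ContinuousAlternatingMap.wedge_add_right _)) with hS
  set ψ : ℤ →+ (E [⋀^Fin (2 * j + 2)]→L[ℝ] ℂ) := zmultiplesHom _ ((j.factorial : ℂ) • γ) with hψ
  have hrange : AddSubgroup.zmultiples ((j.factorial : ℂ) • γ) = AddSubgroup.map ψ ⊤ := by
    rw [← AddMonoidHom.range_eq_map, hψ, AddSubgroup.range_zmultiplesHom]
  have hcomap : S.comap ψ = AddSubgroup.zmultiples (((j + 1 : ℕ) : ℤ)) := by
    ext k
    rw [AddSubgroup.mem_comap, Int.mem_zmultiples_iff, hψ, zmultiplesHom_apply, ← Int.cast_smul_eq_zsmul ℂ]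
    exact h.intCast_smul_mem_map_wedgePow_wedge_iff Φ hη h0 hγ k
  rw [AddSubgroup.relIndex_sup_left, hrange, ← AddSubgroup.relIndex_comap, hcomap, AddSubgroup.relIndex_top_right,
    Int.index_zmultiples, Int.natAbs_natCast]

/-- **The cokernel of the divided power `θ^{[g−2]}` is generated by the minimal class** (type `(1, …, 1)`, `g = j + 2`): with
`θ^{∧(j+1)} = (j+1)! · γ`, `γ ∈ H^{2j+2}(X, ℤ)` and `m = j! · γ = θ^{∧(j+1)}/(j+1)`,
**`j! · H^{2j+2}(X, ℤ) = θ^{∧j} ∧ H²(X, ℤ) ⊔ ℤ · m`** — together with §1 (`k·m ∈ θ^{∧j} ∧ H²(X, ℤ) ⟺ (j+1) ∣ k`):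
`coker(θ^{[g−2]} : H²(X, ℤ) → H^{2g−2}(X, ℤ)) ≅ ℤ/(g−1)`, generated by the minimal class `θ^{[g−1]}`. Proof: both
`[j!·H^{2j+2}(X, ℤ) : S] = j + 1` (g35-#3) and `[S ⊔ ℤm : S] = j + 1`, with `S ⊔ ℤm ⊆ j!·H^{2j+2}(X, ℤ)`.
[cite: Lange2023AbelianVarietiesComplex, §4.2 Poincaré's formula (PDF p. 204), §4.7.1 Cor. 4.7.2 (PDF p. 229), §2.5.3 Thm. 2.5.16, §5.4.1 Thm. 5.4.1 and (5.22) (PDF p. 275)] [cite: VoisinHodgeI2002, §7.1.2 (PDF p. 134 L31)] -/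
theorem IsSymplecticEnum.map_nsmul_eq_map_wedgePow_wedge_sup_zmultiples (h : IsSymplecticEnum Φ e₀ η d)
    (hη : IsRiemannForm Φ η) (h1 : ∀ i, d i = 1) {γ : E [⋀^Fin (2 * j + 2)]→L[ℝ] ℂ} (hγH : γ ∈ integralForms Φ (2 * j + 2))
    (hγ : wedgePow (ofRealForm η) (j + 1) = ((j + 1).factorial : ℂ) • γ) :
    (integralForms Φ (2 * j + 2)).map (nsmulAddMonoidHom j.factorial) =
      (integralForms Φ 2).map (AddMonoidHom.mk'
        (fun x : E [⋀^Fin 2]→L[ℝ] ℂ ↦ (wedgePow (ofRealForm η) j).wedge x)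
        (ContinuousAlternatingMap.wedge_add_right _)) ⊔ AddSubgroup.zmultiples ((j.factorial : ℂ) • γ) := by
  set S := (integralForms Φ 2).map (AddMonoidHom.mk'
        (fun x : E [⋀^Fin 2]→L[ℝ] ℂ ↦ (wedgePow (ofRealForm η) j).wedge x)
        (ContinuousAlternatingMap.wedge_add_right _)) with hS
  set N := (integralForms Φ (2 * j + 2)).map (nsmulAddMonoidHom j.factorial) with hN
  have hSN : S ≤ N := h.map_wedgePow_wedge_integralForms_le_map_nsmul Φ j 2
  have hmN : (j.factorial : ℂ) • γ ∈ N := ⟨γ, hγH, (Nat.cast_smul_eq_nsmul ℂ j.factorial γ).symm⟩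
  have hQN : S ⊔ AddSubgroup.zmultiples ((j.factorial : ℂ) • γ) ≤ N :=
    sup_le hSN (AddSubgroup.zmultiples_le_of_mem hmN)
  refine le_antisymm (AddSubgroup.relIndex_eq_one.1 ?_) hQN
  have hmul := AddSubgroup.relIndex_mul_relIndex S (S ⊔ AddSubgroup.zmultiples ((j.factorial : ℂ) • γ)) N le_sup_left hQN
  rw [h.relIndex_map_wedgePow_wedge_sup_zmultiples Φ hη (h1 0) hγ, hN,
    h.relIndex_map_wedgePow_wedge_map_nsmul_two_of_type_one Φ hη h1] at hmul
  exact Nat.eq_of_mul_eq_mul_left (Nat.succ_pos j) (hmul.trans (mul_one _).symm)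

/-- **The minimal class is not in the image for `g ≥ 3`**: `m = θ^{∧(j+1)}/(j+1) ∉ θ^{∧j} ∧ H²(X, ℤ)` when `d₁ = 1` and `j ≥ 1`
(its class has order `j + 1 ≥ 2`). [cite: Lange2023AbelianVarietiesComplex, §4.2 (PDF p. 204), §5.4.1 (5.22) (PDF p. 275)] -/
theorem IsSymplecticEnum.smul_not_mem_map_wedgePow_wedge (h : IsSymplecticEnum Φ e₀ η d) (hη : IsRiemannForm Φ η)
    (h0 : d 0 = 1) (hj : 1 ≤ j) {γ : E [⋀^Fin (2 * j + 2)]→L[ℝ] ℂ}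
    (hγ : wedgePow (ofRealForm η) (j + 1) = ((j + 1).factorial : ℂ) • γ) :
    (j.factorial : ℂ) • γ ∉ (integralForms Φ 2).map (AddMonoidHom.mk'
        (fun x : E [⋀^Fin 2]→L[ℝ] ℂ ↦ (wedgePow (ofRealForm η) j).wedge x)
        (ContinuousAlternatingMap.wedge_add_right _)) := fun hm ↦ by
  have h1 := (h.intCast_smul_mem_map_wedgePow_wedge_iff Φ hη h0 hγ 1).1 (by rwa [Int.cast_one, one_smul])
  have h2 := Int.eq_one_of_dvd_one (by positivity) h1
  omega

/-! ## §3 Basis-free: principally polarised complex tori -/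

/-- **On a principally polarised complex torus of dimension `g = j + 2` the cokernel of the divided power
`θ^{[g−2]} : H²(X, ℤ) → H^{2g−2}(X, ℤ)` is cyclic of order `g − 1`, generated by the minimal class `θ^{[g−1]}`**: there is
`γ ∈ H^{2g−2}(X, ℤ)` with `θ^{∧(g−1)} = (g−1)! · γ` such that `(g−2)! · H^{2g−2}(X, ℤ) = θ^{∧(g−2)} ∧ H²(X, ℤ) ⊔ ℤ · (g−2)!γ` and
`k · (g−2)!γ ∈ θ^{∧(g−2)} ∧ H²(X, ℤ) ⟺ (g−1) ∣ k` (`|ι| = 2g`). On a p.p. threefold: `H⁴(X, ℤ) = θ ∧ H²(X, ℤ) ⊔ ℤ · θ²/2`,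
quotient `ℤ/2`; on a p.p. fourfold: `2·H⁶(X, ℤ) = θ² ∧ H²(X, ℤ) ⊔ ℤ · θ³/3`, quotient `ℤ/3`.
[cite: Lange2023AbelianVarietiesComplex, §4.2 Poincaré's formula (PDF p. 204), §4.7.1 Cor. 4.7.2 (PDF p. 229), §2.1.1, §2.5.3 Thm. 2.5.16, §5.4.1 Thm. 5.4.1 and (5.22) (PDF p. 275), §1.5.1] [cite: VoisinHodgeI2002, §7.1.2 (PDF p. 134 L31)] -/
theorem IsPrincipalPolarization.exists_minimalClass_generates_cokernel {Φ : (ι → ℝ) ≃L[ℝ] E}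
    (hp : IsPrincipalPolarization Φ η) (hj : Fintype.card ι = 2 * (j + 2)) :
    ∃ γ ∈ integralForms Φ (2 * j + 2), wedgePow (ofRealForm η) (j + 1) = ((j + 1).factorial : ℂ) • γ ∧
      (integralForms Φ (2 * j + 2)).map (nsmulAddMonoidHom j.factorial) =
        (integralForms Φ 2).map (AddMonoidHom.mk'
          (fun x : E [⋀^Fin 2]→L[ℝ] ℂ ↦ (wedgePow (ofRealForm η) j).wedge x)
          (ContinuousAlternatingMap.wedge_add_right _)) ⊔ AddSubgroup.zmultiples ((j.factorial : ℂ) • γ) ∧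
      ∀ k : ℤ, (k : ℂ) • ((j.factorial : ℂ) • γ) ∈ (integralForms Φ 2).map (AddMonoidHom.mk'
          (fun x : E [⋀^Fin 2]→L[ℝ] ℂ ↦ (wedgePow (ofRealForm η) j).wedge x)
          (ContinuousAlternatingMap.wedge_add_right _)) ↔ ((j + 1 : ℕ) : ℤ) ∣ k := by
  obtain ⟨g, d', hd', h1⟩ := hp.exists_type_eq_one
  have hg : j + 2 = g := by have := hd'.card_eq; omega
  obtain ⟨Φ', hΛ, hs⟩ := (hd'.comp_cast hg).exists_isSymplecticEnum Φ
  have hη' : IsRiemannForm Φ' η := hp.isRiemannForm.of_range_latticeVec_subset hΛ.le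
  obtain ⟨γ, hγH, hγ⟩ := hs.exists_mem_integralForms_wedgePow_eq_factorial_smul Φ' (j + 1)
  have h1' : ∀ i : Fin (j + 2), d' (Fin.cast hg i) = 1 := fun i ↦ h1 _
  refine ⟨γ, ?_, hγ, ?_, fun k ↦ ?_⟩
  · rw [integralForms_eq_of_range_latticeVec_eq hΛ.symm (2 * j + 2)]
    exact hγH
  · rw [integralForms_eq_of_range_latticeVec_eq hΛ.symm 2, integralForms_eq_of_range_latticeVec_eq hΛ.symm (2 * j + 2)]
    exact hs.map_nsmul_eq_map_wedgePow_wedge_sup_zmultiples Φ' hη' h1' hγH hγ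
  · rw [integralForms_eq_of_range_latticeVec_eq hΛ.symm 2]
    exact hs.intCast_smul_mem_map_wedgePow_wedge_iff Φ' hη' (h1' 0) hγ k

end DegreeTwoCokernel

end Literature.Geometry.Kaehler.ComplexTorus
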